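import Summits.BirchSwinnertonDyer.BirchSwinnertonDyer.Theorems.KolyvaginDepthDoorDepthTableSteinWuthrichEvenRankBSDQuotient
import Literature.NumberTheory.EllipticCurves.BSDRankZeroDensityProofs
import HarnessLib

/-!
# Route `KolyvaginDepthDoor`, crux `KolyvaginDepthSupplyKN` (stmt-BirchSwinnertonDyer-22820) —
# DEPTH TABLE v15, GENERIC: HOW MUCH `Ш` OF THE TWIST THE CRUX TOLERATES — the `L`-value / BSD-quotient datum with `ord_p ≤ k`
# instead of `≤ 0` (Skinner 2016 Thm. C / Burungale–Castella–Skinner 2025 Cor. 1.3.1 + GZK, BY NAME)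

Helper file of the lead prover of line `levelone` (kdd-p1 g19; `--supports stmt-BirchSwinnertonDyer-22820
--as helper`); it closes nothing and BSD is NOT proved by it.

g18's odd-rank reading (`…OddRankLValue`) and g19's even-rank reading (`…EvenRankBSDQuotient`) ask the datum in its STRONGEST form,
`ord_p ≤ 0` (⟹ `Ш(T)[p] = 0`, `#Sel_p(T) = p^{rank T}`). But the crux's clause at a curve `W` of rank `r` needs only `#Sel_p(T) ≤ p^r`
(g17's `cruxBody_of_twistSelmer_of_steinWuthrich`), while `rank T ∈ {0, 1}`: there is ROOM — `Ш(T)[p]` may have order up to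
`p^{r − rank T}`. This file makes the tolerance explicit:

* `natCard_sha_inf_torsionBy_le_pow_padicValNat` — for finite `Ш`: `#Ш[p] ≤ p^{ord_p #Ш}` (Lagrange + Cauchy: `Ш[p]` is a `p`-group
  inside `Ш`).
* `natCard_selmerGroup_le_pow_of_rankZero_LValue` — ODD rank (twist of analytic rank `0`): Skinner's identity with
  `ord_p(L(T,1)/Ω_T) ≤ k` gives `#Sel_p(T/ℚ) ≤ p^k`.
* `natCard_selmerGroup_le_pow_succ_of_rankOne_bsdQuotient_bcs` — EVEN rank (twist of analytic rank `1`): BCS's identity with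
  `ord_p(L'(T,1)/(Ω_T Reg_T)) ≤ k` gives `#Sel_p(T/ℚ) ≤ p^{k+1}`.
* `cruxBody_of_twistLValue_le_of_steinWuthrich_skinner` / `cruxBody_of_twistBSDQuotient_le_of_steinWuthrich_bcs` — the row mechanisms
  with tolerance: at a curve with `k ≤ rank W` (odd) resp. `k + 1 ≤ rank W` (even) the clause of `KolyvaginDepthSupplyKN` holds at `W`
  from the datum with `ord_p ≤ k`. For the rank-3 rows: `ord_5(L(T,1)/Ω_T) ≤ 3` suffices (`5³ ∣ #Ш_an(T)·Tam` still closes the crux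
  at the curve); for the rank-2 rows: `ord_p(BSD quotient) ≤ 1`.

CONDITIONAL on the named print facts; per `(W, p, K, T)`; nothing class-wide (the open stub (S♭) is untouched); BSD is NOT proved by it.

References: [Skinner2016PacificMC] Thm. C; [BurungaleCastellaSkinner2025] Cor. 1.3.1; [Darmon2004] Thm. 3.22; [SilvermanAEC2009] X.4.2.
-/

set_option linter.dupNamespace false

noncomputable section

open scoped Classical NumberField

namespace Summit.BirchSwinnertonDyer.BirchSwinnertonDyer.Theorems.KolyvaginDepthDoor

open Literature.NumberTheory.EllipticCurves Literature.NumberTheory.EllipticCurves.ModularForms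
  WeierstrassCurve NumberField IsDedekindDomain
open Literature.NumberTheory.EllipticCurves.Rank1Residual
open Summit.BirchSwinnertonDyer.BirchSwinnertonDyer.Theorems

/-- **`#Ш[p] ≤ p^{ord_p #Ш}` for finite `Ш`**: `Ш ⊓ H¹[p]` is a subgroup of `Ш` (Lagrange: its order divides `#Ш`) all of whose elements
are killed by `p` (Cauchy: so its order is a power of `p`). [folklore] -/
theorem natCard_sha_inf_torsionBy_le_pow_padicValNat (V : WeierstrassCurve ℚ) [V.IsElliptic] (p : ℕ) [hp : Fact p.Prime]
    [Finite V.sha] :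
    Nat.card (V.sha ⊓ AddSubgroup.torsionBy V.galH1 (p : ℤ) : AddSubgroup V.galH1) ≤ p ^ padicValNat p (Nat.card V.sha) := by
  set B : AddSubgroup V.galH1 := V.sha ⊓ AddSubgroup.torsionBy V.galH1 (p : ℤ) with hB
  have hle : B ≤ V.sha := inf_le_left
  haveI : Finite B := Finite.of_injective _ (AddSubgroup.inclusion_injective hle)
  have hdvd : Nat.card B ∣ Nat.card V.sha := AddSubgroup.card_dvd_of_le hle
  have hB0 : Nat.card B ≠ 0 := Nat.card_pos.ne'
  have hS0 : Nat.card V.sha ≠ 0 := Nat.card_pos.ne'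
  -- every prime divisor of `#B` is `p`
  have hprime : ∀ {q : ℕ}, q.Prime → q ∣ Nat.card B → q = p := by
    intro q hq hqd
    haveI := Fact.mk hq
    obtain ⟨b, hb⟩ := exists_prime_addOrderOf_dvd_card' (G := B) q hqd
    have hpb : p • (b : V.galH1) = 0 := AddSubgroup.torsionBy.nsmul_iff.mp (AddSubgroup.mem_inf.mp b.2).2
    have hpb' : p • b = 0 := Subtype.ext (by simpa using hpb)
    have h1 : addOrderOf b ∣ p := addOrderOf_dvd_of_nsmul_eq_zero hpb'
    rw [hb] at h1
    exact (Nat.prime_dvd_prime_iff_eq hq hp.out).mp h1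
  have hk := Nat.eq_prime_pow_of_unique_prime_dvd hB0 hprime
  rw [hk]
  apply Nat.pow_le_pow_right hp.out.pos
  have hpk : p ^ (Nat.card B).primeFactorsList.length ∣ Nat.card V.sha := hk ▸ hdvd
  exact (padicValNat_dvd_iff_le hS0).mp hpk

/-- **ODD rank, with tolerance: `#Sel_p(T/ℚ) ≤ p^k` from `ord_p(L(T,1)/Ω_T) ≤ k`** (Skinner 2016 Thm. C + GZK by name; hypotheses as in
`natCard_selmerGroup_eq_one_of_rankZero_LValue`): `r_an(T) = 0` ⟹ rank `0`, `Ш(T)` finite; Skinner: `ord_p(L/Ω) = ord_p #Ш + ord_p Tam`;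
Kodaira–Néron: `ord_p Tam = 0`; so `ord_p #Ш(T) ≤ k` and `#Sel_p(T) = #T(ℚ)[p] · #Ш(T)[p] ≤ 1 · p^k`. CONDITIONAL on the two named facts;
per `(T, p)`; BSD is not proved by it. [cite: Skinner2016PacificMC, Thm. C (p. 173)] [cite: Darmon2004, Thm. 3.22] [cite: SilvermanAEC2009, Thm. X.4.2] -/
theorem natCard_selmerGroup_le_pow_of_rankZero_LValue
    (hSk : Skinner2016_padicValRat_bsd_rank_zero) (hGZK : rank_eq_analyticRank_of_analyticRank_le_one)
    (T : WeierstrassCurve ℚ) [T.IsElliptic] [T.IsGloballyMinimal] (p : ℕ) [hp : Fact p.Prime] (h5 : 5 ≤ p)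
    (hred : (T.HasGoodReductionAtPrime p ∧ ¬ (p : ℤ) ∣ T.frobeniusTrace p) ∨ T.HasMultiplicativeReductionAtPrime p)
    (hirr : T.HasIrreducibleModPGaloisRep p)
    (hram : ∃ q : ℕ, ∃ _ : Fact q.Prime, q ≠ p ∧ T.HasMultiplicativeReductionAtPrime q ∧
      ¬ p ∣ padicValInt q T.minimalDiscriminantInt)
    (hKN : ∀ v : HeightOneSpectrum (𝓞 ℚ), T.HasMultiplicativeReductionAt v → ¬ p ∣ T.ordMinimalDiscriminant v)
    (hL : T.entireLFunction 1 ≠ 0) (k : ℕ)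
    (hval : ∀ q : ℚ, T.entireLFunction 1 / ((T.realPeriodRat : ℝ) : ℂ) = (q : ℂ) → padicValRat p q ≤ k) :
    Nat.card (T.selmerGroup p) ≤ p ^ k := by
  have h0 : T.analyticRank = 0 := analyticRank_eq_zero_of_entireLFunction_one_ne_zero T hL
  obtain ⟨hrank, hfin⟩ := hGZK T (by rw [h0]; norm_num)
  rw [h0] at hrank
  haveI : Finite T.sha := hfin
  obtain ⟨q, hq, hv⟩ := hSk T p (le_trans (by norm_num) h5) hred hirr hram hL hfin
  have hvk : padicValRat p q ≤ k := hval q hq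
  have htam0 : padicValNat p T.tamagawaProduct = 0 :=
    padicValNat.eq_zero_of_not_dvd (not_dvd_tamagawaProduct_of_kodairaNeron T p h5 hKN)
  have hshak : padicValNat p T.shaOrder ≤ k := by
    have : ((padicValNat p T.shaOrder : ℕ) : ℤ) + ((padicValNat p T.tamagawaProduct : ℕ) : ℤ) ≤ k := by rw [← hv]; exact hvk
    omega
  have htor : Nat.card (AddSubgroup.torsionBy T.toAffine.Point (p : ℤ)) = 1 :=
    natCard_torsionBy_eq_one_of_hasIrreducibleModPGaloisRep T p hirr
  have hsha : Nat.card (T.sha ⊓ AddSubgroup.torsionBy T.galH1 (p : ℤ) : AddSubgroup T.galH1) ≤ p ^ k :=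
    (natCard_sha_inf_torsionBy_le_pow_padicValNat T p).trans
      (Nat.pow_le_pow_right hp.out.pos (by rwa [WeierstrassCurve.shaOrder] at hshak))
  have h := T.natCard_selmerGroup_eq hp.out.ne_zero
  rw [hrank, pow_zero, one_mul] at h
  rw [h]
  -- (the `DecidableEq ℚ` instance inside `natCard_selmerGroup_eq` is the classical one: bridge by `convert`)
  have key : ∀ {t s : ℕ}, t = 1 → s ≤ p ^ k → t * s ≤ p ^ k := by
    rintro t s rfl hs; simpa using hs
  exact key (by convert htor) hsha

/-- **EVEN rank, with tolerance: `#Sel_p(T/ℚ) ≤ p^{k+1}` from `ord_p(L'(T,1)/(Ω_T·Reg_T)) ≤ k`** (Burungale–Castella–Skinner 2025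
Cor. 1.3.1 + GZK by name; hypotheses as in `natCard_selmerGroup_eq_of_rankOne_bsdQuotient_bcs`): rank `T = 1`, `Ш(T)` finite, BCS:
`ord_p` of the quotient `= ord_p #Ш + ord_p Tam`, Kodaira–Néron, so `ord_p #Ш(T) ≤ k` and `#Sel_p(T) = p · #T(ℚ)[p] · #Ш(T)[p] ≤ p · p^k`.
CONDITIONAL on the two named facts; per `(T, p)`; BSD is not proved by it. [cite: BurungaleCastellaSkinner2025, Cor. 1.3.1 (p. 4)]
[cite: Darmon2004, Thm. 3.22] [cite: SilvermanAEC2009, Thm. X.4.2] -/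
theorem natCard_selmerGroup_le_pow_succ_of_rankOne_bsdQuotient_bcs
    (hBCS : BurungaleCastellaSkinner2025.cor131_padicValRat_bsd_rank_le_one)
    (hGZK : rank_eq_analyticRank_of_analyticRank_le_one)
    (T : WeierstrassCurve ℚ) [T.IsElliptic] [T.IsGloballyMinimal] (p : ℕ) [hp : Fact p.Prime] (h5 : 5 ≤ p)
    (hcm : ¬ T.HasCM) (hgood : T.HasGoodReductionAtPrime p) (hord : ¬ (p : ℤ) ∣ T.frobeniusTrace p)
    (hsur : T.HasSurjectiveModNGaloisRep p)
    (hKN : ∀ v : HeightOneSpectrum (𝓞 ℚ), T.HasMultiplicativeReductionAt v → ¬ p ∣ T.ordMinimalDiscriminant v)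
    (hr : T.analyticRank = 1) (k : ℕ)
    (hval : ∀ q : ℚ, T.leadingLCoeff / ((T.realPeriodRat * T.regulator : ℝ) : ℂ) = (q : ℂ) → padicValRat p q ≤ k) :
    Nat.card (T.selmerGroup p) ≤ p ^ (k + 1) := by
  have hirr : T.HasIrreducibleModPGaloisRep p := hasIrreducibleModPGaloisRep_of_hasSurjectiveModNGaloisRep T p hsur
  have him : BigIm T p := Summit.BirchSwinnertonDyer.Rank1Residual.X9.bigIm_of_surj T p h5 hsur
  obtain ⟨hrank, hfin⟩ := hGZK T (by rw [hr])
  rw [hr] at hrank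
  haveI : Finite T.sha := hfin
  obtain ⟨q, hq, hv⟩ := hBCS T p hcm (by omega) ⟨hgood, hord⟩ hirr him (by rw [hr]) hfin
  have hvk : padicValRat p q ≤ k := hval q hq
  have htam0 : padicValNat p T.tamagawaProduct = 0 :=
    padicValNat.eq_zero_of_not_dvd (not_dvd_tamagawaProduct_of_kodairaNeron T p h5 hKN)
  have hshak : padicValNat p T.shaOrder ≤ k := by
    have : ((padicValNat p T.shaOrder : ℕ) : ℤ) + ((padicValNat p T.tamagawaProduct : ℕ) : ℤ) ≤ k := by rw [← hv]; exact hvk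
    omega
  have htor : Nat.card (AddSubgroup.torsionBy T.toAffine.Point (p : ℤ)) = 1 :=
    natCard_torsionBy_eq_one_of_hasIrreducibleModPGaloisRep T p hirr
  have hsha : Nat.card (T.sha ⊓ AddSubgroup.torsionBy T.galH1 (p : ℤ) : AddSubgroup T.galH1) ≤ p ^ k :=
    (natCard_sha_inf_torsionBy_le_pow_padicValNat T p).trans
      (Nat.pow_le_pow_right hp.out.pos (by rwa [WeierstrassCurve.shaOrder] at hshak))
  have h := T.natCard_selmerGroup_eq hp.out.ne_zero
  rw [hrank, pow_one] at h
  rw [h]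
  have key : ∀ {t s : ℕ}, t = 1 → s ≤ p ^ k → p * t * s ≤ p ^ (k + 1) := by
    rintro t s rfl hs
    rw [mul_one, pow_succ']
    exact Nat.mul_le_mul_left _ hs
  exact key (by convert htor) hsha

/-- **THE ODD-RANK ROW MECHANISM WITH TOLERANCE `k ≤ rank W`** — as g18's `cruxBody_of_twistLValue_of_steinWuthrich_skinner`, but the
`L`-value datum only needs `ord_p(L(T,1)/Ω_T) ≤ k` for some `k ≤ rank_ℤ W(ℚ)`: then `#Sel_p(T) ≤ p^k ≤ p^{rank W}` and g17's
`cruxBody_of_twistSelmer_of_steinWuthrich` gives the clause of `KolyvaginDepthSupplyKN` at `W` verbatim. For the rank-`3` rows: `p³` may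
divide `#Ш_an(T)·Tam(T)` and the crux still holds at the curve. CONDITIONAL on Stein–Wuthrich Thm. 1.1, W. Zhang L8.4 (1) / 9.1, Skinner 2016
Thm. C, GZK by name; per `(W, p, K, T)`; BSD is not proved by it. [cite: SteinWuthrich2013, Thm. 1.1 (p. 1758)]
[cite: WZhang2014, Lemma 8.4 (1) (p. 236), Thm. 9.1 (p. 240)] [cite: Skinner2016PacificMC, Thm. C (p. 173)] [cite: Darmon2004, Thm. 3.22] -/
theorem cruxBody_of_twistLValue_le_of_steinWuthrich_skinner
    (hSW : SteinWuthrich2013_sha_inf_torsionBy_eq_bot_of_two_le_rank)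
    (h84 : Literature.NumberTheory.EllipticCurves.WZhang2014_lemma84_exists_minimal_kolyvaginClass_one_selmerCard)
    (hSk : Skinner2016_padicValRat_bsd_rank_zero) (hGZK : rank_eq_analyticRank_of_analyticRank_le_one)
    (W : WeierstrassCurve ℚ) [W.IsElliptic] [W.IsGloballyMinimal] (hcm : ¬ W.HasCM) (hr : 2 ≤ W.mordellWeilRank)
    (hN : W.conductorNorm ℤ ≤ 30000)
    (p : ℕ) [hp : Fact p.Prime] (h5 : 5 ≤ p) (hp1000 : p < 1000) (hgood : W.HasGoodReductionAtPrime p)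
    (hord : ¬ (p : ℤ) ∣ W.frobeniusTrace p)
    (htower : ∀ n : ℕ, W.HasSurjectiveModNGaloisRep (p ^ n : ℕ))
    (hKN : ∀ v : HeightOneSpectrum (𝓞 ℚ), W.HasMultiplicativeReductionAt v →
      ¬ p ∣ W.ordMinimalDiscriminant v)
    (hS1 : ∀ (ℓ : ℕ) [Fact ℓ.Prime], W.HasMultiplicativeReductionAtPrime ℓ →
      ¬ p ∣ padicValInt ℓ W.minimalDiscriminantInt)
    (hS2 : ¬ Squarefree (W.conductorNorm ℤ) →
      (∃ (ℓ : ℕ) (_ : Fact ℓ.Prime), W.HasMultiplicativeReductionAtPrime ℓ ∧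
          ¬ p ∣ padicValInt ℓ W.minimalDiscriminantInt) ∧
        ∃ (ℓ₁ ℓ₂ : ℕ) (_ : Fact ℓ₁.Prime) (_ : Fact ℓ₂.Prime), ℓ₁ ≠ ℓ₂ ∧
          W.HasMultiplicativeReductionAtPrime ℓ₁ ∧ W.HasMultiplicativeReductionAtPrime ℓ₂)
    (K : Type) [Field K] [NumberField K] (hK : IsImaginaryQuadratic K)
    (hD3 : NumberField.discr K ≠ -3) (hD4 : NumberField.discr K ≠ -4)
    (hpD : ¬ ((p : ℤ) ∣ NumberField.discr K))
    [iNZ : NeZero (W.conductorNorm ℤ)] (hH : SatisfiesHeegnerHypothesis (W.conductorNorm ℤ) K)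
    (T : WeierstrassCurve ℚ) [T.IsElliptic] [T.IsGloballyMinimal] (C : WeierstrassCurve.VariableChange ℚ)
    (hC : C • T = W.quadraticTwist (NumberField.discr K : ℚ))
    (hTred : (T.HasGoodReductionAtPrime p ∧ ¬ (p : ℤ) ∣ T.frobeniusTrace p) ∨ T.HasMultiplicativeReductionAtPrime p)
    (hTram : ∃ q : ℕ, ∃ _ : Fact q.Prime, q ≠ p ∧ T.HasMultiplicativeReductionAtPrime q ∧
      ¬ p ∣ padicValInt q T.minimalDiscriminantInt)
    (hTKN : ∀ v : HeightOneSpectrum (𝓞 ℚ), T.HasMultiplicativeReductionAt v → ¬ p ∣ T.ordMinimalDiscriminant v)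
    (hL : T.entireLFunction 1 ≠ 0) (k : ℕ) (hk : k ≤ W.mordellWeilRank)
    (hval : ∀ q : ℚ, T.entireLFunction 1 / ((T.realPeriodRat : ℝ) : ℂ) = (q : ℂ) → padicValRat p q ≤ k) :
    ∃ (p : ℕ) (hp : Fact p.Prime), 5 ≤ p ∧ W.HasGoodReductionAtPrime p ∧
      ¬ (p : ℤ) ∣ W.frobeniusTrace p ∧ (∀ n : ℕ, W.HasSurjectiveModNGaloisRep (p ^ n : ℕ)) ∧
      (∀ v : HeightOneSpectrum (𝓞 ℚ), W.HasMultiplicativeReductionAt v →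
        ¬ p ∣ W.ordMinimalDiscriminant v) ∧
      ∃ (K : Type) (_ : Field K) (_ : NumberField K), IsImaginaryQuadratic K ∧
        NumberField.discr K ≠ -3 ∧ NumberField.discr K ≠ -4 ∧
        ∃ (_ : NeZero (W.conductorNorm ℤ)), SatisfiesHeegnerHypothesis (W.conductorNorm ℤ) K ∧
        ∃ (Dt : ModularParametrizationData W (W.conductorNorm ℤ)) (β : ℤ) (ι : K →+* ℂ) (n₁ : ℕ)
          (d : KolyvaginHeegnerData Dt β ι n₁), Squarefree n₁ ∧
          (∀ q ∈ n₁.primeFactors, Zhang2014.IsKolyvaginPrime (W.conductorNorm ℤ) W K p q) ∧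
          d.kolyvaginClass hp.out 1 ≠ 0 ∧
          (n₁.primeFactors.card + 1 ≤ W.mordellWeilRank ∨
            (n₁.primeFactors.card ≤ W.mordellWeilRank ∧
              n₁.primeFactors.card + 1 ≤ (W.quadraticTwist (NumberField.discr K : ℚ)).mordellWeilRank)) := by
  have hdK : (NumberField.discr K : ℚ) ≠ 0 := by exact_mod_cast NumberField.discr_ne_zero K
  have hsur : W.HasSurjectiveModNGaloisRep p := by simpa only [pow_one] using htower 1
  have hirrW : W.HasIrreducibleModPGaloisRep p := hasIrreducibleModPGaloisRep_of_hasSurjectiveModNGaloisRep W p hsur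
  have hirrT : T.HasIrreducibleModPGaloisRep p :=
    (W.hasIrreducibleModPGaloisRep_iff_of_smul_eq_quadraticTwist T hdK hC p).mpr hirrW
  have hSelT : Nat.card (T.selmerGroup p) ≤ p ^ k :=
    natCard_selmerGroup_le_pow_of_rankZero_LValue hSk hGZK T p h5 hTred hirrT hTram hTKN hL k hval
  have hSel : Nat.card ((W.quadraticTwist (NumberField.discr K : ℚ)).selmerGroup p) ≤ p ^ k := by
    rw [← natCard_selmerGroup_eq_of_variableChange (p : ℤ) hC]; exact hSelT
  exact cruxBody_of_twistSelmer_of_steinWuthrich hSW h84 W hcm hr hN p h5 hp1000 hgood hord htower hKN hS1 hS2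
    K hK hD3 hD4 hpD hH (hSel.trans (Nat.pow_le_pow_right hp.out.pos hk))

/-- **THE EVEN-RANK ROW MECHANISM WITH TOLERANCE `k + 1 ≤ rank W`** — as `cruxBody_of_twistBSDQuotient_of_steinWuthrich_bcs`, but the
BSD-quotient datum only needs `ord_p(L'(T,1)/(Ω_T·Reg_T)) ≤ k` for some `k` with `k + 1 ≤ rank_ℤ W(ℚ)`: `#Sel_p(T) ≤ p^{k+1} ≤ p^{rank W}`.
For the rank-`2` rows: `p ∣ #Ш_an(T)·Tam(T)` (once) is still fine. CONDITIONAL on Stein–Wuthrich Thm. 1.1, W. Zhang L8.4 (1) / 9.1, BCS 2025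
Cor. 1.3.1, GZK by name; per `(W, p, K, T)`; BSD is not proved by it. [cite: SteinWuthrich2013, Thm. 1.1 (p. 1758)]
[cite: WZhang2014, Lemma 8.4 (1) (p. 236), Thm. 9.1 (p. 240)] [cite: BurungaleCastellaSkinner2025, Cor. 1.3.1 (p. 4)] [cite: Darmon2004, Thm. 3.22] -/
theorem cruxBody_of_twistBSDQuotient_le_of_steinWuthrich_bcs
    (hSW : SteinWuthrich2013_sha_inf_torsionBy_eq_bot_of_two_le_rank)
    (h84 : Literature.NumberTheory.EllipticCurves.WZhang2014_lemma84_exists_minimal_kolyvaginClass_one_selmerCard)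
    (hBCS : BurungaleCastellaSkinner2025.cor131_padicValRat_bsd_rank_le_one)
    (hGZK : rank_eq_analyticRank_of_analyticRank_le_one)
    (W : WeierstrassCurve ℚ) [W.IsElliptic] [W.IsGloballyMinimal] (hcm : ¬ W.HasCM) (hr : 2 ≤ W.mordellWeilRank)
    (hN : W.conductorNorm ℤ ≤ 30000)
    (p : ℕ) [hp : Fact p.Prime] (h5 : 5 ≤ p) (hp1000 : p < 1000) (hgood : W.HasGoodReductionAtPrime p)
    (hord : ¬ (p : ℤ) ∣ W.frobeniusTrace p)
    (htower : ∀ n : ℕ, W.HasSurjectiveModNGaloisRep (p ^ n : ℕ))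
    (hKN : ∀ v : HeightOneSpectrum (𝓞 ℚ), W.HasMultiplicativeReductionAt v →
      ¬ p ∣ W.ordMinimalDiscriminant v)
    (hS1 : ∀ (ℓ : ℕ) [Fact ℓ.Prime], W.HasMultiplicativeReductionAtPrime ℓ →
      ¬ p ∣ padicValInt ℓ W.minimalDiscriminantInt)
    (hS2 : ¬ Squarefree (W.conductorNorm ℤ) →
      (∃ (ℓ : ℕ) (_ : Fact ℓ.Prime), W.HasMultiplicativeReductionAtPrime ℓ ∧
          ¬ p ∣ padicValInt ℓ W.minimalDiscriminantInt) ∧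
        ∃ (ℓ₁ ℓ₂ : ℕ) (_ : Fact ℓ₁.Prime) (_ : Fact ℓ₂.Prime), ℓ₁ ≠ ℓ₂ ∧
          W.HasMultiplicativeReductionAtPrime ℓ₁ ∧ W.HasMultiplicativeReductionAtPrime ℓ₂)
    (K : Type) [Field K] [NumberField K] (hK : IsImaginaryQuadratic K)
    (hD3 : NumberField.discr K ≠ -3) (hD4 : NumberField.discr K ≠ -4)
    (hpD : ¬ ((p : ℤ) ∣ NumberField.discr K))
    [iNZ : NeZero (W.conductorNorm ℤ)] (hH : SatisfiesHeegnerHypothesis (W.conductorNorm ℤ) K)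
    (T : WeierstrassCurve ℚ) [T.IsElliptic] [T.IsGloballyMinimal] (C : WeierstrassCurve.VariableChange ℚ)
    (hC : C • T = W.quadraticTwist (NumberField.discr K : ℚ))
    (hTgood : T.HasGoodReductionAtPrime p) (hTord : ¬ (p : ℤ) ∣ T.frobeniusTrace p)
    (hTsur : T.HasSurjectiveModNGaloisRep p)
    (hTKN : ∀ v : HeightOneSpectrum (𝓞 ℚ), T.HasMultiplicativeReductionAt v → ¬ p ∣ T.ordMinimalDiscriminant v)
    (hTr : T.analyticRank = 1) (k : ℕ) (hk : k + 1 ≤ W.mordellWeilRank)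
    (hval : ∀ q : ℚ, T.leadingLCoeff / ((T.realPeriodRat * T.regulator : ℝ) : ℂ) = (q : ℂ) → padicValRat p q ≤ k) :
    ∃ (p : ℕ) (hp : Fact p.Prime), 5 ≤ p ∧ W.HasGoodReductionAtPrime p ∧
      ¬ (p : ℤ) ∣ W.frobeniusTrace p ∧ (∀ n : ℕ, W.HasSurjectiveModNGaloisRep (p ^ n : ℕ)) ∧
      (∀ v : HeightOneSpectrum (𝓞 ℚ), W.HasMultiplicativeReductionAt v →
        ¬ p ∣ W.ordMinimalDiscriminant v) ∧
      ∃ (K : Type) (_ : Field K) (_ : NumberField K), IsImaginaryQuadratic K ∧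
        NumberField.discr K ≠ -3 ∧ NumberField.discr K ≠ -4 ∧
        ∃ (_ : NeZero (W.conductorNorm ℤ)), SatisfiesHeegnerHypothesis (W.conductorNorm ℤ) K ∧
        ∃ (Dt : ModularParametrizationData W (W.conductorNorm ℤ)) (β : ℤ) (ι : K →+* ℂ) (n₁ : ℕ)
          (d : KolyvaginHeegnerData Dt β ι n₁), Squarefree n₁ ∧
          (∀ q ∈ n₁.primeFactors, Zhang2014.IsKolyvaginPrime (W.conductorNorm ℤ) W K p q) ∧
          d.kolyvaginClass hp.out 1 ≠ 0 ∧
          (n₁.primeFactors.card + 1 ≤ W.mordellWeilRank ∨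
            (n₁.primeFactors.card ≤ W.mordellWeilRank ∧
              n₁.primeFactors.card + 1 ≤ (W.quadraticTwist (NumberField.discr K : ℚ)).mordellWeilRank)) := by
  have hdK : (NumberField.discr K : ℚ) ≠ 0 := by exact_mod_cast NumberField.discr_ne_zero K
  have hTcm : ¬ T.HasCM := by
    intro hT
    have h1 : (C • T).HasCM := hasCM_variableChange T C hT
    rw [hC] at h1
    exact not_hasCM_quadraticTwist W hdK hcm h1
  have hSelT : Nat.card (T.selmerGroup p) ≤ p ^ (k + 1) :=
    natCard_selmerGroup_le_pow_succ_of_rankOne_bsdQuotient_bcs hBCS hGZK T p h5 hTcm hTgood hTord hTsur hTKN hTr k hval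
  have hSel : Nat.card ((W.quadraticTwist (NumberField.discr K : ℚ)).selmerGroup p) ≤ p ^ (k + 1) := by
    rw [← natCard_selmerGroup_eq_of_variableChange (p : ℤ) hC]; exact hSelT
  exact cruxBody_of_twistSelmer_of_steinWuthrich hSW h84 W hcm hr hN p h5 hp1000 hgood hord htower hKN hS1 hS2
    K hK hD3 hD4 hpD hH (hSel.trans (Nat.pow_le_pow_right hp.out.pos hk))

end Summit.BirchSwinnertonDyer.BirchSwinnertonDyer.Theorems.KolyvaginDepthDoor

end
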